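import Summits.AtomisticToContinuum.Crystallization.Theorems.ChartedZeroExcessLayeredLatticeLiouvilleYF
import Summits.AtomisticToContinuum.Crystallization.Theorems.ChartedZeroExcessLayeredLatticeLiouvilleYG

/-!
(SPLIT FOR THE 400-LINE CAP by the landing lane, hand-2 g32: this file = part 1 of 2; sequels `…ChartedZeroExcessLayeredLatticeLiouvilleYH` import it in a chain; same namespace, all FQNs unchanged.)
# Charted zero-excess layered-lattice Liouville — YH «MildEnclosure» (lens-2 g64 addendum; docket `stmt-AtomisticToContinuum-26636`; CRITIC-LEDGER row 1187)

Row 1187 RULING (a): `gap_and_pert_1_50_of_certs_16XH24B` (part YF) is the 26636 COLUMN OF RECORD on landing, with [CMC] `CoolMoatCorePG` flagged as its ONE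
undischarged local door; (c)(i): «type (K3′)/(K01) under [CMCᶜ], PROVE (K01) first».  Part YH composes part YF's ENCLOSURE cut with part YG's AMPLITUDE cut:

* **YH-1/2/3 — THE DOOR OF RECORD IS NEEDED ONLY IN ITS MILD (PERTURBATIVE) FORM.**  [MCMC] `MildCoolMoatCorePG ϑc ϑ ϑp r q rsh rm` = [CMC] with the extra
  hypothesis «the `rm`-neighbourhood `coreOf S K rm` of the container is `ϑp`-TAME» (the clamped filling is a SMALL perturbation of the chart: bond strain
  `≤ ϑp/4` everywhere on the core — exactly the small-data regime of E–Ming 2007 / Ortner–Theil 2013, where uniqueness-up-to-tameness of the clamped clean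
  filling is the inverse-function theorem about the chart plus the coercivity of the column's (U♮ᴱ)); [MCMCᶜ] its local clamped form.  WEAKER than [CMC] /
  [CMCᶜ] (PROVED, hypothesis added); `[MCMCᶜ] ⇒ [MCMC]` (PROVED).  Exclusion `not_hot_serene_isolated_mild_of_mildCoolMoatCore` (PROVED): under [MCMC] no site
  is hot ∧ serene ∧ isolated ∧ MILD-BALLED (`IsTameBall ϑp rp`, `rp ≥ q + rm`).  The MILD serene count of part YG splits under [MCMC] into MILD-SLENDER + MILD-BURIED
  (sub-counts of part YF's [SSHSᵇ], [BSHSᵇ] AND of part YG's [MSBHSᵇ], all PROVED), glue `mildSereneBareHotSparseBPG_of_mildCoolMoat_slender_buried` (PROVED).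
  ★★★ COLUMN `_16XH26B` = `_16XH24B` with hCMC ↦ hMCMC (MILD door, WEAKER), hSSH ↦ hMSSH, hBSH ↦ hMBSH (sub-counts, WEAKER) and ONE added binder hWHS = [WHSᵇ](1/10)
  `HotSparseBPG (1/10) 1 2 (1/16) (1/50)` (part YD's hot leaf at DOUBLE amplitude, WEAKER than `_16XH24B`'s B-body: `mild_docket_of_record_16XH24B`, PROVED).  EVERY
  binder of `_16XH26B` is implied by the column of record: the undischarged door is now PERTURBATIVE, and what was traded for it is the o(η)-sparsity of `1/10`-WILD
  stars — a statement with a THEOREM at the top of its dial (`hotSparseBPG_of_twelve_le`) and an energy-priced mechanism (part YG docstring).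
* **YH-4 — (K3′)/(K01) TYPED (row 1187 (c)(i)) with the glue `[CMCᶜ] ⟸ (K3′) ∧ (K01)` PROVED.**  (K3′) `CoolMoatSlavingP ϑc ϑ' r q rsh ρ ρ'` «SLAVING: under
  [CMCᶜ]'s binders the `ρ'`-core is `ϑ'`-tame for SOME equilibrium chart `(L′, w′)`» (interior regularity / small-data uniqueness UP TO THE CHART; SIDEWAYS —
  its conclusion is stronger in level and region than [CMCᶜ]'s, honest); (K01) `ChartMatchingP ϑc ϑ' ϑ r q rsh ρ'` «MATCHING: a `ρ'`-core `ϑ'`-tame for `(L′, w′)`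
  whose moat is `ϑc`-tame for `(L, w)` has its container `ϑ`-tame for `(L, w)`» (KINEMATIC, registration-free; the same-chart instance is trivial,
  `isTameOn_of_isTameOn_coreOf`).  HONEST LEVEL BUDGET for (K01): the natural proof (door sets are GLOBALLY layered — no partial dislocation is clean — so a
  `K`-star has a LAYER-MATE star in the moat with the SAME local stacking word; both are `ϑ'`-close to congruent `L′`-patterns (equilibrium charts are
  homogeneous: equal word windows ⇒ congruent patterns up to `ε_w ≈ 10⁻³`, part TH (B1) mechanism); the mate is `ϑc`-close to an `L`-pattern) gives level
  `2ϑ' + ϑc + ε_w`, so (K01) at `(ϑc, ϑ) = (1/100, 1/20)` wants `ϑ' ≤ 1/60`, NOT the `ϑ/2 = 1/40` foreseen in part YF's docstring; the remaining formal work is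
  STAR-BOUNDARY COHERENCE (patching neighbouring stars' `g`-maps, (α)-lane `UntwistCollarP`-type) and the chart word-rigidity `ε_w` — typed here as the ONE
  statement (K01), not proved.  In the MILD class (K3′) with `L′ := L` IS [MCMCᶜ] and (K01) is not needed at all: the matching problem exists only for WILD
  isolated cores, which `_16XH26B` pays through [WHSᵇ](1/10) instead.  Column `_16XH24BS` = `_16XH24B` with hCMC ↦ (K3′)(1/60, ρ 16, ρ' 20) ∧ (K01)(1/60) (PROVED).
No sorry, no new axiom, no instances / notations / option overrides.
-/

noncomputable section

open scoped BigOperators Classical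
open MeasureTheory Set Metric Filter Topology
open Summit.AtomisticToContinuum.Crystallization.Theorems.ChartedPlanarOrderRigidityDoor (E3 eStar atomsIn IsEStarGSC siteEnergy VisibleGap PertRegime)
open Summit.AtomisticToContinuum.Crystallization.Theorems.ChartedPlanarOrderDensityDichotomy (μS IsSep nK nK_nonneg)
open Summit.AtomisticToContinuum.Crystallization.Theorems.ChartedPlanarOrderCleanScaleP (IsCleanP IsDoorSetP)
open Summit.AtomisticToContinuum.Crystallization.Theorems.ChartedPlanarOrderMesoCut (LayeredHom EnvClose)
open Summit.AtomisticToContinuum.Crystallization.Theorems.ChartedPlanarOrderDoorLayered (atomsIn_subset sq_le_finsum_mem PeriodicBulkGapDoor)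
open Summit.AtomisticToContinuum.Crystallization.Theorems.ChartedPlanarOrderDoorLayeredOsc (IsTwoShellAffineGood)
open Literature.MathematicalPhysics.StatisticalMechanics (card_le_of_separated_of_dist_le lennardJones)

namespace Summit.AtomisticToContinuum.Crystallization.Theorems.ChartedZeroExcessLayeredLatticeLiouville

/-! ### YH-1  The MILD enclosure doors [MCMC], [MCMCᶜ]: part YF's doors with a `ϑp`-tame core hypothesis -/

/-- ★★★ **[MCMC] «MildCoolMoatCorePG ϑc ϑ ϑp r q rsh rm aHi Λ θ s» — THE MILD COOL-MOAT ENCLOSURE DOOR**: part YF's [CMC] `CoolMoatCorePG ϑc ϑ r q rsh` with ONE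
extra hypothesis — the `rm`-neighbourhood `coreOf S K rm` of the container is `ϑp`-TAME for the chart (every star there fits a rotated model star within
`ϑp`: the filling is a SMALL perturbation of the chart, bond strain `≤ ϑp/4`).  Conclusion as [CMC]: `K` is `ϑ`-tame.  WEAKER than [CMC] (PROVED); the
small-data uniqueness it encodes is PERTURBATIVE as long as `ϑp` lies inside the chart family's linear-stability radius (IFT about the chart + (U♮ᴱ)).
Record `(ϑc, ϑ, ϑp, r, q, rsh, rm) = (1/100, 1/20, 1/10, 8, 4, 12, 16)`.  LOCAL · FINITE · GSC-priced · UNDECIDED · ATTACKABLE·M (perturbative) · INSTRUMENTABLE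
(«CoolMoatGap» restricted to MILD seeds, «MildMargin(ϑp)»).
Why it might fail: only if `ϑp = 1/10` already exceeds the coercivity radius of the linearised clamped operator (stiffness drift ≈ 50 % at 2.5 % bond strain
against a ≈ 15 % margin, part TP) AND a second clean Nash filling, `1/20`-hot at the centre yet `1/10`-tame throughout, exists under `1 %`-cool data; none known.
Sources: part YF ([CMC], [CMCᶜ]); part YG (amplitude cut); E–Ming, Arch. Ration. Mech. Anal. 183 (2007) 241; Ortner–Theil, Arch. Ration. Mech. Anal. 207 (2013)
1025; Ehrlacher–Ortner–Shapeev, Arch. Ration. Mech. Anal. 222 (2016) 1217; CRITIC-LEDGER row 1187. [this file, g64] -/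
def MildCoolMoatCorePG (ϑc ϑ ϑp r q rsh rm aHi Λ θ s : ℝ) : Prop :=
  ∀ δ : ℝ, 0 < δ → ∀ a : ℝ, 0 < a →
    ∀ S : Set E3, IsDoorSetPG aHi δ S → (∀ p ∈ S, IsTwoShellAffineGood θ S p) →
      ∀ (L : E3 ≃L[ℝ] E3) (w : ℤ → E3), IsEquilChart a s Λ L w →
        ∀ (x₀ : E3) (K : Set E3), K ⊆ S → (∀ k ∈ K, dist k x₀ ≤ q) →
          IsTameOn ϑp S (LayeredHom (L : E3 →L[ℝ] E3) w) (coreOf S K rm) →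
            IsTameOn ϑc S (LayeredHom (L : E3 →L[ℝ] E3) w) (moatIn S K r (r + rsh)) →
              IsTameOn ϑ S (LayeredHom (L : E3 →L[ℝ] E3) w) K

/-- ★★ **[MCMCᶜ] «MildCoolMoatClampedCoreP ϑc ϑ ϑp r q rsh ρ rm aHi Λ θ s» — the MILD small-data uniqueness leaf** ([CMCᶜ] of part YF + the `ϑp`-tame core
hypothesis): door `IsDoorSetP`, summable pair sums, θ-good, equilibrium chart, container in a `q`-ball, `ϑp`-tame `rm`-core, `ϑc`-tame moat, grand clamped
minimality of the `ρ`-core ⇒ `K` is `ϑ`-tame.  WEAKER than [CMCᶜ] (PROVED); `⇒ [MCMC]` (PROVED). [this file, g64] -/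
def MildCoolMoatClampedCoreP (ϑc ϑ ϑp r q rsh ρ rm aHi Λ θ s : ℝ) : Prop :=
  ∀ δ : ℝ, 0 < δ → ∀ a : ℝ, 0 < a →
    ∀ S : Set E3, IsDoorSetP aHi δ S → (∀ z : E3, Summable fun y : S => lennardJones (dist z (y : E3))) →
      (∀ p ∈ S, IsTwoShellAffineGood θ S p) →
        ∀ (L : E3 ≃L[ℝ] E3) (w : ℤ → E3), IsEquilChart a s Λ L w →
          ∀ (x₀ : E3) (K : Set E3), K ⊆ S → (∀ k ∈ K, dist k x₀ ≤ q) →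
            IsTameOn ϑp S (LayeredHom (L : E3 →L[ℝ] E3) w) (coreOf S K rm) →
              IsTameOn ϑc S (LayeredHom (L : E3 →L[ℝ] E3) w) (moatIn S K r (r + rsh)) →
                IsGrandClampedMin S (coreOf S K ρ) → IsTameOn ϑ S (LayeredHom (L : E3 →L[ℝ] E3) w) K

/-- **[CMC] ⇒ [MCMC] (PROVED)** — the mild door is WEAKER than part YF's door of record (a hypothesis is added). [this file, g64] -/
theorem mildCoolMoatCorePG_of_coolMoatCore {ϑc ϑ ϑp r q rsh rm aHi Λ θ s : ℝ} (h : CoolMoatCorePG ϑc ϑ r q rsh aHi Λ θ s) :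
    MildCoolMoatCorePG ϑc ϑ ϑp r q rsh rm aHi Λ θ s :=
  fun δ hδ a ha S hS hgood L w hLw x₀ K hKS hKq _ hcool => h δ hδ a ha S hS hgood L w hLw x₀ K hKS hKq hcool

/-- **[CMCᶜ] ⇒ [MCMCᶜ] (PROVED)** — WEAKER. [this file, g64] -/
theorem mildCoolMoatClampedCoreP_of_clamped {ϑc ϑ ϑp r q rsh ρ rm aHi Λ θ s : ℝ} (h : CoolMoatClampedCoreP ϑc ϑ r q rsh ρ aHi Λ θ s) :
    MildCoolMoatClampedCoreP ϑc ϑ ϑp r q rsh ρ rm aHi Λ θ s :=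
  fun δ hδ a ha S hS hsum hgood L w hLw x₀ K hKS hKq _ hcool hmin => h δ hδ a ha S hS hsum hgood L w hLw x₀ K hKS hKq hcool hmin

/-- **[MCMCᶜ](ρ) ⇒ [MCMC] (PROVED, every `ρ`)** — as part YF: on an e⋆-GSC door set every core is grand-clamped-minimal and pair sums are summable. [this file, g64] -/
theorem mildCoolMoatCorePG_of_mildClamped {ϑc ϑ ϑp r q rsh ρ rm aHi Λ θ s : ℝ} (h : MildCoolMoatClampedCoreP ϑc ϑ ϑp r q rsh ρ rm aHi Λ θ s) :
    MildCoolMoatCorePG ϑc ϑ ϑp r q rsh rm aHi Λ θ s :=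
  fun δ hδ a ha S hS hgood L w hLw x₀ K hKS hKq hmild hcool =>
    h δ hδ a ha S hS.isDoorSetP (summable_of_isEStarGSC hS.gsc) hgood L w hLw x₀ K hKS hKq hmild hcool
      (isGrandClampedMin_of_isEStarGSC hS.gsc (coreOf_subset S K ρ))

/-- **DIAL (PROVED): [MCMC] is WEAKER at a lower mild level** (`ϑp' ≤ ϑp`: the hypothesis `ϑp'`-tame core is stronger). [this file, g64] -/
theorem MildCoolMoatCorePG.of_level_le {ϑc ϑ ϑp ϑp' r q rsh rm aHi Λ θ s : ℝ} (hle : ϑp' ≤ ϑp) (h : MildCoolMoatCorePG ϑc ϑ ϑp r q rsh rm aHi Λ θ s) :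
    MildCoolMoatCorePG ϑc ϑ ϑp' r q rsh rm aHi Λ θ s :=
  fun δ hδ a ha S hS hgood L w hLw x₀ K hKS hKq hmild hcool =>
    h δ hδ a ha S hS hgood L w hLw x₀ K hKS hKq (IsTameOn.mono hle subset_rfl hmild) hcool

/-- **DIAL (PROVED): [MCMC] is WEAKER at a larger mild radius** (`rm ≤ rm'`: the hypothesis tame on the larger core is stronger). [this file, g64] -/
theorem MildCoolMoatCorePG.of_rm_le {ϑc ϑ ϑp r q rsh rm rm' aHi Λ θ s : ℝ} (hle : rm ≤ rm') (h : MildCoolMoatCorePG ϑc ϑ ϑp r q rsh rm aHi Λ θ s) :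
    MildCoolMoatCorePG ϑc ϑ ϑp r q rsh rm' aHi Λ θ s :=
  fun δ hδ a ha S hS hgood L w hLw x₀ K hKS hKq hmild hcool =>
    h δ hδ a ha S hS hgood L w hLw x₀ K hKS hKq (IsTameOn.mono le_rfl (coreOf_mono S K hle) hmild) hcool

/-! ### YH-2  Mild-balled sites have mild cores; the sitewise exclusion in the mild class; the mild residual counts and leaves; the glue -/

/-- a site with a `ϑp`-tame `rp`-ball has a `ϑp`-tame `rm`-core around any container in its `q`-ball, `q + rm ≤ rp` (PROVED). [this file, g64] -/
theorem isTameOn_coreOf_of_isTameBall {ϑp rp q rm : ℝ} {S H K : Set E3} {x : E3} (hKq : ∀ k ∈ K, dist k x ≤ q) (hrm : q + rm ≤ rp)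
    (hb : IsTameBall ϑp rp S H x) : IsTameOn ϑp S H (coreOf S K rm) := by
  intro p hp
  have hp' : p ∈ S ∧ ∃ k ∈ K, dist p k ≤ rm := hp
  obtain ⟨hpS, k, hkK, hpk⟩ := hp'
  have h3 : dist p x ≤ dist p k + dist k x := dist_triangle p k x
  have hkx : dist k x ≤ q := hKq k hkK
  exact hb p hpS (by linarith)

/-- ★★★ **SITEWISE EXCLUSION IN THE MILD CLASS (PROVED)**: under [MCMC] (`0 ≤ q`, `ra ≥ r + rsh + q`, `D ≥ 2r + rsh + q`, `rp ≥ q + rm`) no site of a θ-good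
e⋆-GSC door set is HOT ∧ SERENE ∧ ISOLATED ∧ MILD-BALLED — part YF's key lemma gives the cool moat, the mild ball gives the mild core. [this file, g64] -/
theorem not_hot_serene_isolated_mild_of_mildCoolMoatCore {ϑc ϑ ϑp r ra q rsh D rm rp aHi Λ θ s : ℝ} (hq : 0 ≤ q) (hra : r + rsh + q ≤ ra)
    (hD : 2 * r + rsh + q ≤ D) (hrm : q + rm ≤ rp) (hC : MildCoolMoatCorePG ϑc ϑ ϑp r q rsh rm aHi Λ θ s) {δ : ℝ} (hδ : 0 < δ) {a : ℝ} (ha : 0 < a)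
    {S : Set E3} (hS : IsDoorSetPG aHi δ S) (hgood : ∀ p ∈ S, IsTwoShellAffineGood θ S p) {L : E3 ≃L[ℝ] E3} {w : ℤ → E3} (hLw : IsEquilChart a s Λ L w)
    {x : E3} (hx : x ∈ S) (hot : ¬ IsTameStar ϑ S (LayeredHom (L : E3 →L[ℝ] E3) w) x) (hser : ¬ IsAgitated ϑc ϑ r ra S (LayeredHom (L : E3 →L[ℝ] E3) w) x)
    (hmild : IsTameBall ϑp rp S (LayeredHom (L : E3 →L[ℝ] E3) w) x) : ¬ IsHotIsolated ϑ q D S (LayeredHom (L : E3 →L[ℝ] E3) w) x := fun hiso =>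
  hot (hC δ hδ a ha S hS hgood L w hLw x (hotCluster ϑ q S (LayeredHom (L : E3 →L[ℝ] E3) w) x) (fun _ hz => hz.1) (fun _ hk => hk.2.1)
    (isTameOn_coreOf_of_isTameBall (fun _ hk => hk.2.1) hrm hmild) (isTameOn_moat_hotCluster_of_serene hra hD hser hiso) x
    ⟨hx, by rw [dist_self]; exact hq, hot⟩)

/-- number of MILD SLENDER serene bare hot sites of `Q`: bare, hot, serene, mild-balled, LINKED and not `b`-buried. [this file, g64] -/
def mildSlenderSereneHotCount (ϑc ϑ r ra ϑe ωe : ℝ) (p : ℕ) (r₀ ℓ : ℝ) (M : ℕ) (q D b ϑp rp : ℝ) (S H Q : Set E3) : ℝ :=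
  ∑ᶠ x ∈ Q, if ¬ IsDressed ϑe ωe p r₀ ℓ M S H x ∧ ¬ IsTameStar ϑ S H x ∧ ¬ IsAgitated ϑc ϑ r ra S H x ∧ IsTameBall ϑp rp S H x ∧
    ¬ IsHotIsolated ϑ q D S H x ∧ ¬ IsBuried ϑ b S H x then (1 : ℝ) else 0

/-- number of MILD BURIED serene bare hot sites of `Q`: bare, hot, serene, mild-balled and `b`-buried. [this file, g64] -/
def mildBuriedSereneHotCount (ϑc ϑ r ra ϑe ωe : ℝ) (p : ℕ) (r₀ ℓ : ℝ) (M : ℕ) (b ϑp rp : ℝ) (S H Q : Set E3) : ℝ :=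
  ∑ᶠ x ∈ Q, if ¬ IsDressed ϑe ωe p r₀ ℓ M S H x ∧ ¬ IsTameStar ϑ S H x ∧ ¬ IsAgitated ϑc ϑ r ra S H x ∧ IsTameBall ϑp rp S H x ∧ IsBuried ϑ b S H x
    then (1 : ℝ) else 0

/-- `mildSlenderSereneHotCount_nonneg`. [formal bookkeeping] -/
theorem mildSlenderSereneHotCount_nonneg (ϑc ϑ r ra ϑe ωe : ℝ) (p : ℕ) (r₀ ℓ : ℝ) (M : ℕ) (q D b ϑp rp : ℝ) (S H Q : Set E3) :
    0 ≤ mildSlenderSereneHotCount ϑc ϑ r ra ϑe ωe p r₀ ℓ M q D b ϑp rp S H Q :=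
  finsum_nonneg fun x => finsum_nonneg fun _ => by split_ifs <;> norm_num

/-- `mildBuriedSereneHotCount_nonneg`. [formal bookkeeping] -/
theorem mildBuriedSereneHotCount_nonneg (ϑc ϑ r ra ϑe ωe : ℝ) (p : ℕ) (r₀ ℓ : ℝ) (M : ℕ) (b ϑp rp : ℝ) (S H Q : Set E3) :
    0 ≤ mildBuriedSereneHotCount ϑc ϑ r ra ϑe ωe p r₀ ℓ M b ϑp rp S H Q :=
  finsum_nonneg fun x => finsum_nonneg fun _ => by split_ifs <;> norm_num

/-- `mildBuriedSereneHotCount` is monotone in the window. [formal bookkeeping] -/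
theorem mildBuriedSereneHotCount_mono {ϑc ϑ r ra ϑe ωe : ℝ} {p : ℕ} {r₀ ℓ : ℝ} {M : ℕ} {b ϑp rp : ℝ} {S H Q Q' : Set E3} (hQ' : Q'.Finite) (h : Q ⊆ Q') :
    mildBuriedSereneHotCount ϑc ϑ r ra ϑe ωe p r₀ ℓ M b ϑp rp S H Q ≤ mildBuriedSereneHotCount ϑc ϑ r ra ϑe ωe p r₀ ℓ M b ϑp rp S H Q' :=
  finsum_mem_le_finsum_mem_of_subset_of_nonneg hQ' h fun x _ => by split_ifs <;> norm_num

/-- sub-count (PROVED): mild slender ⊆ slender (part YF). [this file, g64] -/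
theorem mildSlenderSereneHotCount_le_slender {ϑc ϑ r ra ϑe ωe : ℝ} {p : ℕ} {r₀ ℓ : ℝ} {M : ℕ} {q D b ϑp rp : ℝ} {S H Q : Set E3} (hQ : Q.Finite) :
    mildSlenderSereneHotCount ϑc ϑ r ra ϑe ωe p r₀ ℓ M q D b ϑp rp S H Q ≤ slenderSereneHotCount ϑc ϑ r ra ϑe ωe p r₀ ℓ M q D b S H Q := by
  rw [mildSlenderSereneHotCount, slenderSereneHotCount, finsum_mem_eq_finite_toFinset_sum _ hQ, finsum_mem_eq_finite_toFinset_sum _ hQ]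
  refine Finset.sum_le_sum fun x _ => ?_
  by_cases h : ¬ IsDressed ϑe ωe p r₀ ℓ M S H x ∧ ¬ IsTameStar ϑ S H x ∧ ¬ IsAgitated ϑc ϑ r ra S H x ∧ IsTameBall ϑp rp S H x ∧
      ¬ IsHotIsolated ϑ q D S H x ∧ ¬ IsBuried ϑ b S H x
  · rw [if_pos h, if_pos ⟨h.1, h.2.1, h.2.2.1, h.2.2.2.2.1, h.2.2.2.2.2⟩]
  · rw [if_neg h]
    split_ifs <;> norm_num

/-- sub-count (PROVED): mild buried ⊆ buried (part YF). [this file, g64] -/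
theorem mildBuriedSereneHotCount_le_buried {ϑc ϑ r ra ϑe ωe : ℝ} {p : ℕ} {r₀ ℓ : ℝ} {M : ℕ} {b ϑp rp : ℝ} {S H Q : Set E3} (hQ : Q.Finite) :
    mildBuriedSereneHotCount ϑc ϑ r ra ϑe ωe p r₀ ℓ M b ϑp rp S H Q ≤ buriedSereneHotCount ϑc ϑ r ra ϑe ωe p r₀ ℓ M b S H Q := by
  rw [mildBuriedSereneHotCount, buriedSereneHotCount, finsum_mem_eq_finite_toFinset_sum _ hQ, finsum_mem_eq_finite_toFinset_sum _ hQ]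
  refine Finset.sum_le_sum fun x _ => ?_
  by_cases h : ¬ IsDressed ϑe ωe p r₀ ℓ M S H x ∧ ¬ IsTameStar ϑ S H x ∧ ¬ IsAgitated ϑc ϑ r ra S H x ∧ IsTameBall ϑp rp S H x ∧ IsBuried ϑ b S H x
  · rw [if_pos h, if_pos ⟨h.1, h.2.1, h.2.2.1, h.2.2.2.2⟩]
  · rw [if_neg h]
    split_ifs <;> norm_num

/-- sub-count (PROVED): mild slender ⊆ mild serene bare hot (part YG). [this file, g64] -/
theorem mildSlenderSereneHotCount_le_mildSerene {ϑc ϑ r ra ϑe ωe : ℝ} {p : ℕ} {r₀ ℓ : ℝ} {M : ℕ} {q D b ϑp rp : ℝ} {S H Q : Set E3} (hQ : Q.Finite) :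
    mildSlenderSereneHotCount ϑc ϑ r ra ϑe ωe p r₀ ℓ M q D b ϑp rp S H Q ≤ mildSereneBareHotCount ϑc ϑ ϑp r ra rp ϑe ωe p r₀ ℓ M S H Q := by
  rw [mildSlenderSereneHotCount, mildSereneBareHotCount, finsum_mem_eq_finite_toFinset_sum _ hQ, finsum_mem_eq_finite_toFinset_sum _ hQ]
  refine Finset.sum_le_sum fun x _ => ?_
  by_cases h : ¬ IsDressed ϑe ωe p r₀ ℓ M S H x ∧ ¬ IsTameStar ϑ S H x ∧ ¬ IsAgitated ϑc ϑ r ra S H x ∧ IsTameBall ϑp rp S H x ∧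
      ¬ IsHotIsolated ϑ q D S H x ∧ ¬ IsBuried ϑ b S H x
  · have hno : ¬ (IsDressed ϑe ωe p r₀ ℓ M S H x ∨ IsTameStar ϑ S H x ∨ IsAgitated ϑc ϑ r ra S H x ∨ ¬ IsTameBall ϑp rp S H x) := fun h' =>
      h'.elim h.1 (fun h₂ => h₂.elim h.2.1 (fun h₃ => h₃.elim h.2.2.1 (fun h₄ => h₄ h.2.2.2.1)))
    rw [if_pos h, if_neg hno]
  · rw [if_neg h]
    split_ifs <;> norm_num

/-- sub-count (PROVED): mild buried ⊆ mild serene bare hot (part YG). [this file, g64] -/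
theorem mildBuriedSereneHotCount_le_mildSerene {ϑc ϑ r ra ϑe ωe : ℝ} {p : ℕ} {r₀ ℓ : ℝ} {M : ℕ} {b ϑp rp : ℝ} {S H Q : Set E3} (hQ : Q.Finite) :
    mildBuriedSereneHotCount ϑc ϑ r ra ϑe ωe p r₀ ℓ M b ϑp rp S H Q ≤ mildSereneBareHotCount ϑc ϑ ϑp r ra rp ϑe ωe p r₀ ℓ M S H Q := by
  rw [mildBuriedSereneHotCount, mildSereneBareHotCount, finsum_mem_eq_finite_toFinset_sum _ hQ, finsum_mem_eq_finite_toFinset_sum _ hQ]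
  refine Finset.sum_le_sum fun x _ => ?_
  by_cases h : ¬ IsDressed ϑe ωe p r₀ ℓ M S H x ∧ ¬ IsTameStar ϑ S H x ∧ ¬ IsAgitated ϑc ϑ r ra S H x ∧ IsTameBall ϑp rp S H x ∧ IsBuried ϑ b S H x
  · have hno : ¬ (IsDressed ϑe ωe p r₀ ℓ M S H x ∨ IsTameStar ϑ S H x ∨ IsAgitated ϑc ϑ r ra S H x ∨ ¬ IsTameBall ϑp rp S H x) := fun h' =>
      h'.elim h.1 (fun h₂ => h₂.elim h.2.1 (fun h₃ => h₃.elim h.2.2.1 (fun h₄ => h₄ h.2.2.2.1)))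
    rw [if_pos h, if_neg hno]
  · rw [if_neg h]
    split_ifs <;> norm_num

/-- ★★ **THE MILD SERENE COUNT SPLITS UNDER [MCMC] (PROVED)**: `mildSereneBareHotCount ≤ mildSlender + mildBuried` on finite `Q ⊆ S` of a θ-good e⋆-GSC door
set with an equilibrium chart (`0 ≤ q`, `ra ≥ r + rsh + q`, `D ≥ 2r + rsh + q`, `rp ≥ q + rm`) — the mild isolated class is EMPTY. [this file, g64] -/
theorem mildSereneBareHotCount_le_slender_add_buried_of_mildCoolMoatCore {ϑc ϑ ϑp r ra ϑe ωe : ℝ} {p : ℕ} {r₀ ℓ : ℝ} {M : ℕ}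
    {q rsh D b rm rp aHi Λ θ s : ℝ} (hq : 0 ≤ q) (hra : r + rsh + q ≤ ra) (hD : 2 * r + rsh + q ≤ D) (hrm : q + rm ≤ rp)
    (hC : MildCoolMoatCorePG ϑc ϑ ϑp r q rsh rm aHi Λ θ s) {δ : ℝ} (hδ : 0 < δ) {a : ℝ} (ha : 0 < a) {S : Set E3} (hS : IsDoorSetPG aHi δ S)
    (hgood : ∀ p' ∈ S, IsTwoShellAffineGood θ S p') {L : E3 ≃L[ℝ] E3} {w : ℤ → E3} (hLw : IsEquilChart a s Λ L w) {Q : Set E3} (hQ : Q.Finite) (hQS : Q ⊆ S) :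
    mildSereneBareHotCount ϑc ϑ ϑp r ra rp ϑe ωe p r₀ ℓ M S (LayeredHom (L : E3 →L[ℝ] E3) w) Q ≤
      mildSlenderSereneHotCount ϑc ϑ r ra ϑe ωe p r₀ ℓ M q D b ϑp rp S (LayeredHom (L : E3 →L[ℝ] E3) w) Q +
        mildBuriedSereneHotCount ϑc ϑ r ra ϑe ωe p r₀ ℓ M b ϑp rp S (LayeredHom (L : E3 →L[ℝ] E3) w) Q := by
  rw [mildSereneBareHotCount, mildSlenderSereneHotCount, mildBuriedSereneHotCount, finsum_mem_eq_finite_toFinset_sum _ hQ,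
    finsum_mem_eq_finite_toFinset_sum _ hQ, finsum_mem_eq_finite_toFinset_sum _ hQ, ← Finset.sum_add_distrib]
  refine Finset.sum_le_sum fun x hx => ?_
  have hxS : x ∈ S := hQS (hQ.mem_toFinset.1 hx)
  by_cases hd : IsDressed ϑe ωe p r₀ ℓ M S (LayeredHom (L : E3 →L[ℝ] E3) w) x ∨ IsTameStar ϑ S (LayeredHom (L : E3 →L[ℝ] E3) w) x ∨
      IsAgitated ϑc ϑ r ra S (LayeredHom (L : E3 →L[ℝ] E3) w) x ∨ ¬ IsTameBall ϑp rp S (LayeredHom (L : E3 →L[ℝ] E3) w) x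
  · rw [if_pos hd]
    exact add_nonneg (by split_ifs <;> norm_num) (by split_ifs <;> norm_num)
  · rw [if_neg hd]
    have hnd : ¬ IsDressed ϑe ωe p r₀ ℓ M S (LayeredHom (L : E3 →L[ℝ] E3) w) x := fun h' => hd (Or.inl h')
    have hnt : ¬ IsTameStar ϑ S (LayeredHom (L : E3 →L[ℝ] E3) w) x := fun h' => hd (Or.inr (Or.inl h'))
    have hna : ¬ IsAgitated ϑc ϑ r ra S (LayeredHom (L : E3 →L[ℝ] E3) w) x := fun h' => hd (Or.inr (Or.inr (Or.inl h')))
    have hmb : IsTameBall ϑp rp S (LayeredHom (L : E3 →L[ℝ] E3) w) x := by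
      by_contra h'
      exact hd (Or.inr (Or.inr (Or.inr h')))
    have hni : ¬ IsHotIsolated ϑ q D S (LayeredHom (L : E3 →L[ℝ] E3) w) x :=
      not_hot_serene_isolated_mild_of_mildCoolMoatCore hq hra hD hrm hC hδ ha hS hgood hLw hxS hnt hna hmb
    by_cases hb : IsBuried ϑ b S (LayeredHom (L : E3 →L[ℝ] E3) w) x
    · simp [hnd, hnt, hna, hmb, hni, hb]
    · simp [hnd, hnt, hna, hmb, hni, hb]

/-- ★★ **[MSSHSᵇ] «MildSlenderSereneHotSparseBPG …» — MILD SLENDER serene bare hot sites are `o(η)`-sparse**: part YF's [SSHSᵇ] restricted to sites with a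
`ϑp`-tame `rp`-ball.  WEAKER than [SSHSᵇ] AND than part YG's [MSBHSᵇ] (sub-counts, PROVED).  Inhabitants: slender (thin / extended) hot networks of bond strain in
`(1.25 %, 2.5 %]` with no wild site within `rp` — MILD ELASTIC FILAMENTS / SHEETS; mechanism: part YF's feathered excision, now LINEARISED (gain `≥ c·ϑ²` per
site certified by the chart's quadratic form since the whole neighbourhood is in the perturbative class).  UNDECIDED · ATTACKABLE·M · INSTRUMENTABLE. [this file, g64] -/
def MildSlenderSereneHotSparseBPG (ϑc ϑ r ra ϑe ωe : ℝ) (p : ℕ) (r₀ ℓ : ℝ) (M : ℕ) (q D b ϑp rp aHi Λ θ s : ℝ) : Prop :=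
  CountSparseBPG (fun S H _ Q => mildSlenderSereneHotCount ϑc ϑ r ra ϑe ωe p r₀ ℓ M q D b ϑp rp S H Q) aHi Λ θ s

/-- ★★ **[MBSHSᵇ] «MildBuriedSereneHotSparseBPG …» — MILD BURIED serene bare hot sites are `o(η)`-sparse**: part YF's [BSHSᵇ] restricted to sites with a
`ϑp`-tame `rp`-ball — interiors of FAT MILD LUMPS (uniform bond strain in `(1.25 %, 2.5 %]` over radius `> rp`).  WEAKER than [BSHSᵇ] AND than [MSBHSᵇ]
(sub-counts, PROVED).  Mechanism: volume-vs-surface excision LINEARISED about the chart (the lump is in the perturbative class throughout: the arbitrary-volume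
enclosure lemma is here a statement about the LINEARISED clamped operator with mild data — a discrete Saint-Venant / De Giorgi decay for a uniformly elliptic
system, (U♮ᴱ) providing ellipticity).  UNDECIDED · ATTACKABLE·M · INSTRUMENTABLE («AmplitudeHistogram»: do fat MILD hot lumps occur at all?). [this file, g64] -/
def MildBuriedSereneHotSparseBPG (ϑc ϑ r ra ϑe ωe : ℝ) (p : ℕ) (r₀ ℓ : ℝ) (M : ℕ) (b ϑp rp aHi Λ θ s : ℝ) : Prop :=
  CountSparseBPG (fun S H _ Q => mildBuriedSereneHotCount ϑc ϑ r ra ϑe ωe p r₀ ℓ M b ϑp rp S H Q) aHi Λ θ s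

/-- **[SSHSᵇ] ⇒ [MSSHSᵇ] (PROVED)** — WEAKER (sub-count). [this file, g64] -/
theorem mildSlenderSereneHotSparseBPG_of_slender {ϑc ϑ r ra ϑe ωe : ℝ} {p : ℕ} {r₀ ℓ : ℝ} {M : ℕ} {q D b ϑp rp aHi Λ θ s : ℝ}
    (h : SlenderSereneHotSparseBPG ϑc ϑ r ra ϑe ωe p r₀ ℓ M q D b aHi Λ θ s) :
    MildSlenderSereneHotSparseBPG ϑc ϑ r ra ϑe ωe p r₀ ℓ M q D b ϑp rp aHi Λ θ s :=
  CountSparseBPG.of_pointwise_le (fun _ _ _ _ hQ _ _ => mildSlenderSereneHotCount_le_slender hQ) h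

/-- **[BSHSᵇ] ⇒ [MBSHSᵇ] (PROVED)** — WEAKER (sub-count). [this file, g64] -/
theorem mildBuriedSereneHotSparseBPG_of_buried {ϑc ϑ r ra ϑe ωe : ℝ} {p : ℕ} {r₀ ℓ : ℝ} {M : ℕ} {b ϑp rp aHi Λ θ s : ℝ}
    (h : BuriedSereneHotSparseBPG ϑc ϑ r ra ϑe ωe p r₀ ℓ M b aHi Λ θ s) : MildBuriedSereneHotSparseBPG ϑc ϑ r ra ϑe ωe p r₀ ℓ M b ϑp rp aHi Λ θ s :=
  CountSparseBPG.of_pointwise_le (fun _ _ _ _ hQ _ _ => mildBuriedSereneHotCount_le_buried hQ) h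

/-- **[MSBHSᵇ] ⇒ [MSSHSᵇ] (PROVED)** — WEAKER (sub-count). [this file, g64] -/
theorem mildSlenderSereneHotSparseBPG_of_mildSerene {ϑc ϑ r ra ϑe ωe : ℝ} {p : ℕ} {r₀ ℓ : ℝ} {M : ℕ} {q D b ϑp rp aHi Λ θ s : ℝ}
    (h : MildSereneBareHotSparseBPG ϑc ϑ ϑp r ra rp ϑe ωe p r₀ ℓ M aHi Λ θ s) :
    MildSlenderSereneHotSparseBPG ϑc ϑ r ra ϑe ωe p r₀ ℓ M q D b ϑp rp aHi Λ θ s :=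
  CountSparseBPG.of_pointwise_le (fun _ _ _ _ hQ _ _ => mildSlenderSereneHotCount_le_mildSerene hQ) h

/-- **[MSBHSᵇ] ⇒ [MBSHSᵇ] (PROVED)** — WEAKER (sub-count). [this file, g64] -/
theorem mildBuriedSereneHotSparseBPG_of_mildSerene {ϑc ϑ r ra ϑe ωe : ℝ} {p : ℕ} {r₀ ℓ : ℝ} {M : ℕ} {b ϑp rp aHi Λ θ s : ℝ}
    (h : MildSereneBareHotSparseBPG ϑc ϑ ϑp r ra rp ϑe ωe p r₀ ℓ M aHi Λ θ s) :
    MildBuriedSereneHotSparseBPG ϑc ϑ r ra ϑe ωe p r₀ ℓ M b ϑp rp aHi Λ θ s :=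
  CountSparseBPG.of_pointwise_le (fun _ _ _ _ hQ _ _ => mildBuriedSereneHotCount_le_mildSerene hQ) h

/-- ★★★ **GLUE (PROVED): [MCMC] ∧ [MSSHSᵇ] ∧ [MBSHSᵇ] ⇒ [MSBHSᵇ]** (`aHi ≤ 8/7`, `0 ≤ q`, `ra ≥ r + rsh + q`, `D ≥ 2r + rsh + q`, `rp ≥ q + rm`): part YF's glue
in the mild class. [this file, g64] -/
theorem mildSereneBareHotSparseBPG_of_mildCoolMoat_slender_buried {ϑc ϑ ϑp r ra ϑe ωe : ℝ} {p : ℕ} {r₀ ℓ : ℝ} {M : ℕ} {q rsh D b rm rp aHi Λ θ s : ℝ}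
    (haHi : aHi ≤ 8 / 7) (hq : 0 ≤ q) (hra : r + rsh + q ≤ ra) (hD : 2 * r + rsh + q ≤ D) (hrm : q + rm ≤ rp)
    (hC : MildCoolMoatCorePG ϑc ϑ ϑp r q rsh rm aHi Λ θ s) (hSl : MildSlenderSereneHotSparseBPG ϑc ϑ r ra ϑe ωe p r₀ ℓ M q D b ϑp rp aHi Λ θ s)
    (hBu : MildBuriedSereneHotSparseBPG ϑc ϑ r ra ϑe ωe p r₀ ℓ M b ϑp rp aHi Λ θ s) :
    MildSereneBareHotSparseBPG ϑc ϑ ϑp r ra rp ϑe ωe p r₀ ℓ M aHi Λ θ s := by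
  have hsum : CountSparseBPG (fun S H _ Q => mildSlenderSereneHotCount ϑc ϑ r ra ϑe ωe p r₀ ℓ M q D b ϑp rp S H Q +
      mildBuriedSereneHotCount ϑc ϑ r ra ϑe ωe p r₀ ℓ M b ϑp rp S H Q) aHi Λ θ s :=
    CountSparseBPG.of_le_add (cntB := fun S H _ Q => mildSlenderSereneHotCount ϑc ϑ r ra ϑe ωe p r₀ ℓ M q D b ϑp rp S H Q)
      (cntC := fun S H _ Q => mildBuriedSereneHotCount ϑc ϑ r ra ϑe ωe p r₀ ℓ M b ϑp rp S H Q) haHi (fun _ _ _ _ _ _ _ => le_rfl)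
      (fun _ _ _ _ _ hQ' hQQ' => mildBuriedSereneHotCount_mono hQ' hQQ') hSl hBu
  intro δ hδ a ha Cg hCg εw hεw K₀ hK₀
  obtain ⟨η₁, hη₁, R₁, hR₁, h1⟩ := hsum δ hδ a ha Cg hCg εw hεw K₀ hK₀
  refine ⟨η₁, hη₁, R₁, hR₁, fun S hS hgood η hη hηle R hR L w hLw Ψ hΨ hBI hfat => ?_⟩
  exact (mildSereneBareHotCount_le_slender_add_buried_of_mildCoolMoatCore hq hra hD hrm hC hδ ha hS hgood hLw (finite_atomsIn hδ hS.1.2.1 R)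
    (atomsIn_subset S R)).trans (h1 S hS hgood η hη hηle R hR L w hLw Ψ hΨ hBI hfat)

end Summit.AtomisticToContinuum.Crystallization.Theorems.ChartedZeroExcessLayeredLatticeLiouville
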